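import Literature.Computability.Complexity.OccurrenceObstructionsIPExceptional
import Literature.Computability.Complexity.OccurrenceObstructionsDischarge
import Literature.Computability.Complexity.OccurrenceObstructionsIPHookPositivity
import Literature.Computability.Complexity.OccurrenceObstructionsProofs
import Literature.Computability.AlgebraicComplexity.PermanentVsDeterminantProofs
import HarnessLib

/-!
# Ikenmeyer–Panova 2017: Thm. 1.3 (the Kronecker bound under `dc(per) ≤ size`), Thm. 1.4 for
# permanents of size `≤ 18` unconditionally, and the complete assembly of Thm. 1.4 from
# Prop. 2.8 and Thm. 4.6

Sibling proofs file (D-0014) of `Literature/Computability/Complexity/OccurrenceObstructionsIP.lean`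
(the named fact `ikenmeyerPanova2017_thm_1_4`); theorems only, no statement of the tree is changed.
Letters as there: `n` = PERMANENT size, `m` = DETERMINANT size, `d` = outer degree (IP write `m`,
`n`, `d`), everything over `ℂ`, `V = ℂ^{m²}` with the lexicographic matrix variables `MatIdx m`,
`Z = \overline{GL_{m²} · X₀₀^{m-n} per_n}` for IP's padded permanent (`bipPaddedPerFormLex ℂ n m`,
padding variable `X₀₀` a variable OF `per_n`), `Ω_m = \overline{GL_{m²} · det_m}`
(`detFormLex ℂ m`), `q_λ = orbitMultiplicity ℂ (bipPaddedPerFormLex ℂ n m) m (partitionWeightLex m λ)`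
(IP's `q^m_λ(d[n])`, the weight pinning the degree), `g(λ, m × d, m × d) = kroneckerCoeff ℂ λ
(rectangle m d) (rectangle m d)`.

1. **IP Thm. 1.3 (held arXiv text: Thm. 3; "see for example [BLMW:11]")**: "If
   `q^m_λ(d[n]) > g(λ, n × d, n × d)`, then `dc(per_m) > n`" — PROVED
   (`ikenmeyerPanova2017_thm_1_3`), in the tree's vocabulary `dc = determinantalComplexity` of
   `perPoly (Fin n) ℂ`: an affine determinantal representation of `per_n` of size `m ≥ n` puts
   `X₀₀^{m-n} per_n` (top-left block) into `End · det_m ⊆ Ω_m` (Mulmuley–Sohoni's homogenisation,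
   `X_pow_mul_rename_mem_endOrbit_detPoly`, `endOrbit_subset_orbitClosure_holds`; for IP's padding:
   `bipPaddedPerPoly_mem_orbitClosure_detPoly_of_hasDetRepr`), so `Z ⊆ Ω_m`, restriction
   `ℂ[Ω_m] ↠ ℂ[Z]` gives `q_λ ≤ mult_λ ℂ[Ω_m]` (`orbitMultiplicity_le_of_mem_orbitClosure_holds`) and
   the algebraic Peter–Weyl theorem gives `mult_λ ℂ[Ω_m] ≤ g(λ, m × d, m × d)`
   (`orbitMultiplicity_det_le_kroneckerCoeff_holds`): `ikenmeyerPanova2017_thm_1_3_le`.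
2. **IP Thm. 1.4 for small permanents, unconditionally.** By Grenet's bound
   `dc(per_n) ≤ 2ⁿ - 1` (tree theorem `determinantalComplexity_perPoly_le_holds`) and Thm. 1.3,
   every `λ` occurring in `ℂ[Z]` has `g(λ, m × d, m × d) ≥ q_λ ≥ 1` as soon as `2ⁿ - 1 ≤ m`
   (`ikenmeyerPanova2017_thm_1_4_of_two_pow_le`); since `2ⁿ - 1 ≤ 3n⁴ + 1` for `n ≤ 18`, IP's
   hypothesis `3n⁴ < m` alone yields Thm. 1.4 for every permanent size `n ≤ 18`
   (`ikenmeyerPanova2017_thm_1_4_of_le_eighteen`). In particular the window "`n = 2`,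
   `48 < m < 243`" left open by the printed proof (which applies Thm. 1.7(b), parameter `≥ 3`, to
   the permanent size; see the docstring of `ikenmeyerPanova2017_thm_1_4`) is closed by printed
   means: Thm. 1.3 + Grenet (`dc(per_2) = 2`).
3. **The complete assembly.** `ikenmeyerPanova2017_thm_1_4_of_prop_2_8_of_thm_4_6_all`:
   `ikenmeyerPanova2017_prop_2_8 → ikenmeyerPanova2017_thm_4_6 → ikenmeyerPanova2017_thm_1_4`
   with NO side condition — `n ≤ 18` by item 2, `n ≥ 3` by the printed route
   (`ikenmeyerPanova2017_thm_1_4_of_prop_2_8_of_thm_4_6` of `OccurrenceObstructionsIPExceptional.lean`,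
   where Thm. 1.7(a), the transposition property, Kadish–Landsberg and the BLMW lift are theorems).
   Hence the verbatim fact rests on exactly two named facts of IP's paper: Prop. 2.8 (inequality of
   multiplicities: Manivel's stability + Kadish–Landsberg lifting + Peter–Weyl + finiteness of
   `dc`) and Thm. 4.6 (main Kronecker positivity).
4. **Addenda (after the discharge of Prop. 2.8 upstream).** IP Prop. 2.8 is now the tree
   theorem `ikenmeyerPanova2017_prop_2_8_holds` (`OccurrenceObstructionsIPProofs.lean`: Manivel's
   stability `kroneckerCoeff_rowLift_le`, Kadish–Landsberg lifting, Peter–Weyl, uniform Valiant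
   size), so the verbatim fact rests on IP Thm. 4.6 ALONE:
   `ikenmeyerPanova2017_thm_1_4_of_thm_4_6_all : ikenmeyerPanova2017_thm_4_6 →
   ikenmeyerPanova2017_thm_1_4`. Independently, Bürgisser–Ikenmeyer–Panova's "no occurrence
   obstructions" theorem for IP's padding (`bip2019_no_occurrence_obstructions_holds`, BIP J. AMS 32
   (2019) Thm. 1.4, PROVED in `OccurrenceObstructionsDischarge.lean`) and the algebraic Peter–Weyl
   bound give IP Thm. 1.4 unconditionally at BIP's threshold `n ^ 25 ≤ m`
   (`ikenmeyerPanova2017_thm_1_4_of_pow_le`; positivity form of the bound: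
   `kroneckerCoeff_pos_of_hasHighestWeight_detOrbitRep`). What remains conditional on Thm. 4.6 is
   exactly the range `19 ≤ n`, `3n⁴ < m < n²⁵` (and there only the degrees `d > m/n`, the
   degrees `d ≤ m/n` being settled by Prop. 2.8 inside the printed proof).

## References

* C. Ikenmeyer, G. Panova, *Rectangular Kronecker coefficients and plethysms in geometric
  complexity theory*, Adv. Math. 319 (2017) 40–66 = arXiv:1512.03798: Thm. 1.3 (held: Thm. 3),
  Thm. 1.4 (held: Thm. 4) and §1.1 ("Proof of Thm. 1.4", held p. 5). [key `IkenmeyerPanova2017`]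
* P. Bürgisser, J. M. Landsberg, L. Manivel, J. Weyman, SIAM J. Comput. 40 (2011), §5.2
  (Prop. 5.2.1: the Kronecker bound for `ℂ[GL · det]`). [key `BurgisserEtAl2011`]
* B. Grenet, *An upper bound for the permanent versus determinant problem* (2011), Thm. 1.
  [key `Grenet2011`]
* K. Mulmuley, M. Sohoni, SIAM J. Comput. 31 (2001), §4, Prop. 4.4 (`End · f ⊆ Δ[f]`, padding).
  [key `MulmuleySohoni2001`]
* P. Bürgisser, C. Ikenmeyer, G. Panova, *No occurrence obstructions in geometric complexity
  theory*, J. AMS 32 (2019) 163–193, Thm. 1.4 (for the padding `X₁₁^{n-m} per_m`, §1(a) (1.2)).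
  [key `BurgisserIkenmeyerPanovaJAMS2019`]
-/

noncomputable section

open MvPolynomial

namespace Literature.Computability.Complexity

/-! ### IP's padded permanent lies in `Ω_m` as soon as `dc(per_n) ≤ m` -/

section Padding

variable {k : Type*} [Field k]

/-- **Mulmuley–Sohoni's padding for IP's padded permanent.** Over an infinite field, an affine
determinantal representation of `per_n` of size `m ≥ n` puts `X₀₀^{m-n} · per_n(top-left block)`
(`bipPaddedPerPoly`, the padding variable being a variable of `per_n`) into the orbit closure of
`det_m` — indeed into `End · det_m`: homogenise the affine entries with `X₀₀`
(`AlgebraicComplexity.X_pow_mul_rename_mem_endOrbit_detPoly`) and use `End · det_m ⊆ Δ[det_m]`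
(`AlgebraicComplexity.endOrbit_subset_orbitClosure_holds`). The same statement for the
fresh-variable padding is `AlgebraicComplexity.paddedPerPoly_mem_orbitClosure_detPoly_of_hasDetRepr_holds`.
[cite: MulmuleySohoni2001, Prop. 4.4] -/
theorem bipPaddedPerPoly_mem_orbitClosure_detPoly_of_hasDetRepr [Infinite k] {n m : ℕ} [NeZero m]
    (h : AlgebraicComplexity.HasDetRepr (AlgebraicComplexity.perPoly (Fin n) k) m) (hnm : n ≤ m) :
    bipPaddedPerPoly k n m ∈
      AlgebraicComplexity.orbitClosure (AlgebraicComplexity.detPoly (Fin m) k) := by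
  classical
  -- the top-left block index type has `n` elements
  set e : Fin n ≃ TopBlockIdx n m :=
    (Fintype.equivFinOfCardEq (Fintype.card_fin_lt_of_le hnm)).symm with he
  have hper : AlgebraicComplexity.perPoly (TopBlockIdx n m) k =
      rename (Prod.map e e) (AlgebraicComplexity.perPoly (Fin n) k) :=
    (AlgebraicComplexity.rename_perPoly_equiv e).symm
  refine AlgebraicComplexity.endOrbit_subset_orbitClosure_holds _ ?_
  rw [bipPaddedPerPoly, hper, rename_rename]
  have hhom : (AlgebraicComplexity.perPoly (Fin n) k).IsHomogeneous n := by
    simpa using (AlgebraicComplexity.perPoly_isHomogeneous (n := Fin n) (k := k))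
  exact AlgebraicComplexity.X_pow_mul_rename_mem_endOrbit_detPoly hhom hnm h _ _

/-- The same in the lexicographically ordered matrix variables `MatIdx m`:
`bipPaddedPerFormLex k n m ∈ Δ[detFormLex k m] = Ω_m` whenever `per_n` has an affine determinantal
representation of size `m ≥ n` (transport along `rename toLex`,
`rename_mem_orbitClosure_rename_iff_holds`). [cite: MulmuleySohoni2001, Prop. 4.4] -/
theorem bipPaddedPerFormLex_mem_orbitClosure_detFormLex_of_hasDetRepr [Infinite k] {n m : ℕ}
    [NeZero m] (h : AlgebraicComplexity.HasDetRepr (AlgebraicComplexity.perPoly (Fin n) k) m)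
    (hnm : n ≤ m) :
    bipPaddedPerFormLex k n m ∈ AlgebraicComplexity.orbitClosure
      (Literature.NumberTheory.DiophantineGeometry.detFormLex k m) :=
  (Literature.NumberTheory.DiophantineGeometry.rename_mem_orbitClosure_rename_iff_holds toLex
      (AlgebraicComplexity.detPoly (Fin m) k) (bipPaddedPerPoly k n m)).mpr
    (bipPaddedPerPoly_mem_orbitClosure_detPoly_of_hasDetRepr h hnm)

end Padding

/-! ### IP Thm. 1.3: the Kronecker bound for `q` under `dc(per_n) ≤ m` -/

section Thm13

open Literature.NumberTheory.DiophantineGeometry (kroneckerCoeff orbitMultiplicity HasHighestWeight)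

/-- **IP Thm. 1.3, inequality form.** If `per_n` has an affine determinantal representation of
size `m` (`dc(per_n) ≤ m`, with `n ≤ m`), then for every `λ ⊢ m·d` with at most `m²` parts the
multiplicity `q_λ` of the weight of `λ` in `ℂ[Z]`, `Z = \overline{GL_{m²} · X₀₀^{m-n} per_n}`
(IP's padding), is at most `g(λ, m × d, m × d)`: `Z ⊆ Ω_m`
(`bipPaddedPerFormLex_mem_orbitClosure_detFormLex_of_hasDetRepr`), so `q_λ ≤ mult_λ ℂ[Ω_m]` by the
equivariant surjection `ℂ[Ω_m] ↠ ℂ[Z]`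
(`AlgebraicComplexity.orbitMultiplicity_le_of_mem_orbitClosure_holds`), and
`mult_λ ℂ[Ω_m] ≤ g(λ, m × d, m × d)` by the algebraic Peter–Weyl theorem
(`orbitMultiplicity_det_le_kroneckerCoeff_holds`, BLMW Prop. 5.2.1). IP state the contrapositive
(`ikenmeyerPanova2017_thm_1_3`). [cite: IkenmeyerPanova2017, Thm. 1.3 (held: Thm. 3)] -/
theorem ikenmeyerPanova2017_thm_1_3_le {n m d : ℕ} [NeZero m] (hnm : n ≤ m)
    (hdc : AlgebraicComplexity.HasDetRepr (AlgebraicComplexity.perPoly (Fin n) ℂ) m)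
    (lam : Nat.Partition (m * d)) (hlam : lam.parts.card ≤ m * m) :
    orbitMultiplicity ℂ (bipPaddedPerFormLex ℂ n m) m (partitionWeightLex m lam) ≤
      kroneckerCoeff ℂ lam (Nat.Partition.rectangle m d) (Nat.Partition.rectangle m d) :=
  (AlgebraicComplexity.orbitMultiplicity_le_of_mem_orbitClosure_holds _ _ (NeZero.ne m)
      (Literature.NumberTheory.DiophantineGeometry.detFormLex_isHomogeneous ℂ m)
      (bipPaddedPerFormLex_isHomogeneous hnm)
      (bipPaddedPerFormLex_mem_orbitClosure_detFormLex_of_hasDetRepr hdc hnm) _).trans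
    (Literature.NumberTheory.DiophantineGeometry.orbitMultiplicity_det_le_kroneckerCoeff_holds
      (k := ℂ) lam hlam)

/-- **Ikenmeyer–Panova, Adv. Math. 319 (2017), Thm. 1.3 (held arXiv text: Thm. 3, "see for
example [BLMW:11]").** "If `q^m_λ(d[n]) > g(λ, n × d, n × d)`, then `dc(per_m) > n`." In this
file's letters (permanent `n`, determinant `m`): if for some `λ ⊢ m·d` (at most `m²` parts,
automatic in print) the multiplicity `q_λ` of `λ` in `ℂ[\overline{GL_{m²} · X₀₀^{m-n} per_n}]`
exceeds `g(λ, m × d, m × d)`, then `m < dc(per_n)` (`AlgebraicComplexity.determinantalComplexity`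
of `perPoly (Fin n) ℂ`). For `n ≤ m` this is the contrapositive of
`ikenmeyerPanova2017_thm_1_3_le` (`dc(per_n) ≤ m` gives a representation of size `m`,
`hasDetRepr_iff_determinantalComplexity_le_holds`); for `m < n` (where the padded permanent is
junk) it holds because `n ≤ dc(per_n)` (`le_determinantalComplexity_perPoly`).
[cite: IkenmeyerPanova2017, Thm. 1.3 (held: Thm. 3)] -/
theorem ikenmeyerPanova2017_thm_1_3 {n m d : ℕ} [NeZero m] (lam : Nat.Partition (m * d))
    (hlam : lam.parts.card ≤ m * m)
    (hq : kroneckerCoeff ℂ lam (Nat.Partition.rectangle m d) (Nat.Partition.rectangle m d) <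
      orbitMultiplicity ℂ (bipPaddedPerFormLex ℂ n m) m (partitionWeightLex m lam)) :
    m < AlgebraicComplexity.determinantalComplexity (AlgebraicComplexity.perPoly (Fin n) ℂ) := by
  rcases Nat.lt_or_ge m n with hmn | hnm
  · exact hmn.trans_le (AlgebraicComplexity.le_determinantalComplexity_perPoly (k := ℂ) n)
  · by_contra hle
    push Not at hle
    have hdc : AlgebraicComplexity.HasDetRepr (AlgebraicComplexity.perPoly (Fin n) ℂ) m :=
      (AlgebraicComplexity.hasDetRepr_iff_determinantalComplexity_le_holds _ m).mpr hle
    exact absurd (ikenmeyerPanova2017_thm_1_3_le hnm hdc lam hlam) (not_le.mpr hq)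

/-- **Positivity form of Thm. 1.3**: if `dc(per_n) ≤ m` (an affine determinantal representation of
size `m ≥ n`), then every `λ ⊢ m·d` (at most `m²` parts) occurring in
`ℂ[\overline{GL_{m²} · X₀₀^{m-n} per_n}]` (IP's padding, `bipPaddedPerOrbitRep`) has
`g(λ, m × d, m × d) > 0` — occurrence means `q_λ ≥ 1` (the highest-weight spaces of `ℂ[Z]` are
finite-dimensional, `finiteDimensional_highestWeightSpace_orbitCoordRep_holds`), and
`q_λ ≤ g` (`ikenmeyerPanova2017_thm_1_3_le`). This is the conclusion of IP Thm. 1.4 with its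
hypothesis `3n⁴ < m` replaced by `dc(per_n) ≤ m`. [cite: IkenmeyerPanova2017, Thm. 1.3 (held: Thm. 3)] -/
theorem ikenmeyerPanova2017_thm_1_4_of_hasDetRepr {n m d : ℕ} [NeZero m] (hnm : n ≤ m)
    (hdc : AlgebraicComplexity.HasDetRepr (AlgebraicComplexity.perPoly (Fin n) ℂ) m)
    (lam : Nat.Partition (m * d)) (hlam : lam.parts.card ≤ m * m)
    (h : HasHighestWeight (bipPaddedPerOrbitRep ℂ n m) (partitionWeightLex m lam)) :
    0 < kroneckerCoeff ℂ lam (Nat.Partition.rectangle m d) (Nat.Partition.rectangle m d) := by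
  haveI := Literature.NumberTheory.DiophantineGeometry.finiteDimensional_highestWeightSpace_orbitCoordRep_holds
    (k := ℂ) (σ := Literature.NumberTheory.DiophantineGeometry.MatIdx m) (bipPaddedPerFormLex ℂ n m)
    (NeZero.ne m) (partitionWeightLex m lam)
  have hq : 0 < orbitMultiplicity ℂ (bipPaddedPerFormLex ℂ n m) m (partitionWeightLex m lam) := by
    rw [Literature.NumberTheory.DiophantineGeometry.orbitMultiplicity,
      Literature.NumberTheory.DiophantineGeometry.hwMultiplicity, pos_iff_ne_zero, Ne,
      Submodule.finrank_eq_zero]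
    exact h
  exact hq.trans_le (ikenmeyerPanova2017_thm_1_3_le hnm hdc lam hlam)

end Thm13

/-! ### Grenet's bound and IP Thm. 1.4 for permanents of size `≤ 18` -/

section SmallPermanents

open Literature.NumberTheory.DiophantineGeometry (kroneckerCoeff HasHighestWeight)

/-- **Grenet**: `per_n` (`n ≥ 1`) has an affine determinantal representation of every size
`m ≥ 2ⁿ - 1` (tree theorems `AlgebraicComplexity.determinantalComplexity_perPoly_le_holds`,
`dc(per_n) ≤ 2ⁿ - 1`, and `AlgebraicComplexity.hasDetRepr_iff_determinantalComplexity_le_holds`).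
[cite: Grenet2011, Thm. 1] -/
theorem hasDetRepr_perPoly_of_two_pow_le {n m : ℕ} (hn : 1 ≤ n) (hm : 2 ^ n - 1 ≤ m) :
    AlgebraicComplexity.HasDetRepr (AlgebraicComplexity.perPoly (Fin n) ℂ) m :=
  (AlgebraicComplexity.hasDetRepr_iff_determinantalComplexity_le_holds _ m).mpr
    ((AlgebraicComplexity.determinantalComplexity_perPoly_le_holds ℂ n hn).trans hm)

/-- **IP Thm. 1.4 at threshold `2ⁿ - 1 ≤ m`, unconditionally** (Thm. 1.3 + Grenet): for `0 < n`,
`2ⁿ - 1 ≤ m` and `λ ⊢ m·d` (at most `m²` parts) occurring in `ℂ[\overline{GL_{m²} · X₀₀^{m-n} per_n}]`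
(IP's padding), `g(λ, m × d, m × d) > 0`. (For `n ≥ 19` this threshold is weaker than IP's
`3n⁴ < m`; for `n ≤ 18` it is implied by it, `ikenmeyerPanova2017_thm_1_4_of_le_eighteen`.)
[cite: IkenmeyerPanova2017, Thm. 1.3 and Thm. 1.4 (held: Thm. 3, Thm. 4)] -/
theorem ikenmeyerPanova2017_thm_1_4_of_two_pow_le {n m d : ℕ} [NeZero m] (hn : 0 < n)
    (hnm : 2 ^ n - 1 ≤ m) (lam : Nat.Partition (m * d)) (hlam : lam.parts.card ≤ m * m)
    (h : HasHighestWeight (bipPaddedPerOrbitRep ℂ n m) (partitionWeightLex m lam)) :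
    0 < kroneckerCoeff ℂ lam (Nat.Partition.rectangle m d) (Nat.Partition.rectangle m d) := by
  have h2 : n < 2 ^ n := Nat.lt_two_pow_self
  exact ikenmeyerPanova2017_thm_1_4_of_hasDetRepr (by omega) (hasDetRepr_perPoly_of_two_pow_le hn hnm)
    lam hlam h

/-- `2ⁿ - 1 ≤ 3n⁴ + 1` for `n ≤ 18` (and this fails from `n = 19` on: `2¹⁹ = 524288 >
3·19⁴ + 2 = 390965`), so IP's hypothesis `3n⁴ < m` gives `2ⁿ - 1 ≤ m` for `n ≤ 18`. [folklore] -/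
theorem two_pow_sub_one_le_of_le_eighteen {n m : ℕ} (hn : n ≤ 18) (hnm : 3 * n ^ 4 < m) :
    2 ^ n - 1 ≤ m := by
  have h : 2 ^ n ≤ 3 * n ^ 4 + 2 := by
    interval_cases n <;> norm_num
  omega

/-- **IP Thm. 1.4 for every permanent of size `n ≤ 18`, unconditionally** — in particular for
`n = 2`, closing the window `48 < m < 243` not covered by the printed proof (which needs the
parameter `n ≥ 3` of Thm. 1.7(b)): for `0 < n ≤ 18`, `3n⁴ < m`, every `λ ⊢ m·d` (at most `m²` parts)
occurring in `ℂ[\overline{GL_{m²} · X₀₀^{m-n} per_n}]` has `g(λ, m × d, m × d) > 0`, by Thm. 1.3 and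
Grenet's `dc(per_n) ≤ 2ⁿ - 1 ≤ 3n⁴ + 1 ≤ m`. For these sizes IP's theorem carries no information on
`dc(per_n)` beyond Grenet's bound, exactly as IP remark after Thm. 1.3.
[cite: IkenmeyerPanova2017, Thm. 1.4 (held: Thm. 4), via Thm. 1.3 (held: Thm. 3)] -/
theorem ikenmeyerPanova2017_thm_1_4_of_le_eighteen {n m d : ℕ} [NeZero m] (hn : 0 < n)
    (h18 : n ≤ 18) (hnm : 3 * n ^ 4 < m) (lam : Nat.Partition (m * d))
    (hlam : lam.parts.card ≤ m * m)
    (h : HasHighestWeight (bipPaddedPerOrbitRep ℂ n m) (partitionWeightLex m lam)) :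
    0 < kroneckerCoeff ℂ lam (Nat.Partition.rectangle m d) (Nat.Partition.rectangle m d) :=
  ikenmeyerPanova2017_thm_1_4_of_two_pow_le hn (two_pow_sub_one_le_of_le_eighteen h18 hnm) lam hlam h

/-- The case `n = 2` of `ikenmeyerPanova2017_thm_1_4` holds for EVERY determinant size `m ≥ 3`
(`2² - 1 = 3`), in particular throughout the window `48 < m < 243`.
[cite: IkenmeyerPanova2017, Thm. 1.4 (held: Thm. 4), case m = 2, via Thm. 1.3] -/
theorem ikenmeyerPanova2017_thm_1_4_two {m d : ℕ} [NeZero m] (hm : 3 ≤ m)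
    (lam : Nat.Partition (m * d)) (hlam : lam.parts.card ≤ m * m)
    (h : HasHighestWeight (bipPaddedPerOrbitRep ℂ 2 m) (partitionWeightLex m lam)) :
    0 < kroneckerCoeff ℂ lam (Nat.Partition.rectangle m d) (Nat.Partition.rectangle m d) :=
  ikenmeyerPanova2017_thm_1_4_of_two_pow_le (n := 2) Nat.two_pos (by norm_num; exact hm) lam hlam h

end SmallPermanents

/-! ### The complete assembly of IP Thm. 1.4 from Prop. 2.8 and Thm. 4.6 -/

section Assembly

/-- **IP Thm. 1.4 (`ikenmeyerPanova2017_thm_1_4`, verbatim, all permanent sizes) from IP Prop. 2.8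
and IP Thm. 4.6 alone.** For `n ≤ 18` the statement is the unconditional
`ikenmeyerPanova2017_thm_1_4_of_le_eighteen` (Thm. 1.3 + Grenet); for `n ≥ 19 ≥ 3` it is IP's
printed proof (§1.1, held p. 5), assembled in `OccurrenceObstructionsIPExceptional.lean` as
`ikenmeyerPanova2017_thm_1_4_of_prop_2_8_of_thm_4_6` from Prop. 2.8 (⇒ Cor. 1.6), Thm. 4.6 (⇒
Thm. 1.7(b), with the proved transposition property), the proved Thm. 1.7(a), Kadish–Landsberg
(`bip2019_thm_2_1_holds`) and the BLMW lift. Once `ikenmeyerPanova2017_prop_2_8` and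
`ikenmeyerPanova2017_thm_4_6` are discharged, `ikenmeyerPanova2017_thm_1_4_holds` is this theorem
applied to their `_holds`. [cite: IkenmeyerPanova2017, Thm. 1.4 (held: Thm. 4) and §1.1 (Proof of Thm. 1.4; held p. 5)] -/
theorem ikenmeyerPanova2017_thm_1_4_of_prop_2_8_of_thm_4_6_all (h28 : ikenmeyerPanova2017_prop_2_8)
    (h46 : ikenmeyerPanova2017_thm_4_6) : ikenmeyerPanova2017_thm_1_4 := by
  intro n m d _ hn hnm lam hlam h
  by_cases h18 : n ≤ 18
  · exact ikenmeyerPanova2017_thm_1_4_of_le_eighteen hn h18 hnm lam hlam h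
  · exact ikenmeyerPanova2017_thm_1_4_of_prop_2_8_of_thm_4_6 h28 h46 hn hnm (fun h2 => by omega)
      lam hlam h

/-- The same assembly from the four printed ingredients in their vendored form — Cor. 1.6,
Thm. 1.7(a) (proved: `ikenmeyerPanova2017_thm_1_7a_holds`), Thm. 1.7(b) — i.e. IP's "Proof of
Thm. 1.4" verbatim for `n ≥ 3` (`ikenmeyerPanova2017_thm_1_4_of_parts'`) completed below `n = 19`
by Thm. 1.3 + Grenet. [cite: IkenmeyerPanova2017, §1.1 (Proof of Thm. 1.4; held: Proof of Thm. 4, p. 5)] -/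
theorem ikenmeyerPanova2017_thm_1_4_of_cor_1_6_of_thm_1_7b (h16 : ikenmeyerPanova2017_cor_1_6)
    (h17b : ikenmeyerPanova2017_thm_1_7b) : ikenmeyerPanova2017_thm_1_4 := by
  intro n m d _ hn hnm lam hlam h
  by_cases h18 : n ≤ 18
  · exact ikenmeyerPanova2017_thm_1_4_of_le_eighteen hn h18 hnm lam hlam h
  · exact ikenmeyerPanova2017_thm_1_4_of_parts' h16 ikenmeyerPanova2017_thm_1_7a_holds h17b
      (by omega) hnm lam hlam h

end Assembly

/-! ### Addenda: Thm. 1.4 from Thm. 4.6 alone, and unconditionally for `n ^ 25 ≤ m` -/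

section Addenda

open Literature.NumberTheory.DiophantineGeometry (kroneckerCoeff orbitMultiplicity HasHighestWeight)

/-- **Occurrence in `ℂ[Ω_m]` gives a positive rectangular Kronecker coefficient** (positivity
form of the algebraic Peter–Weyl bound, BLMW Prop. 5.2.1: `mult_λ ℂ[Ω_m]_d ≤ g(λ, m × d, m × d)`,
tree theorem `orbitMultiplicity_det_le_kroneckerCoeff_holds`): if the weight of `λ ⊢ m·d`
(at most `m²` parts) occurs in `ℂ[\overline{GL_{m²} · det_m}]` (`detOrbitRep`), then
`g(λ, m × d, m × d) ≥ mult_λ ≥ 1`, the highest-weight spaces of `ℂ[Ω_m]` being finite-dimensional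
(`finiteDimensional_highestWeightSpace_orbitCoordRep_holds`). This is the step "(1.1) ⇒
`g > 0`" of IP §1.1 and of BIP §1(a). [cite: BurgisserEtAl2011, §5.2 Prop. 5.2.1] -/
theorem kroneckerCoeff_pos_of_hasHighestWeight_detOrbitRep {m d : ℕ} [NeZero m]
    (lam : Nat.Partition (m * d)) (hlam : lam.parts.card ≤ m * m)
    (h : HasHighestWeight (Literature.NumberTheory.DiophantineGeometry.detOrbitRep ℂ m)
      (partitionWeightLex m lam)) :
    0 < kroneckerCoeff ℂ lam (Nat.Partition.rectangle m d) (Nat.Partition.rectangle m d) := by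
  haveI := Literature.NumberTheory.DiophantineGeometry.finiteDimensional_highestWeightSpace_orbitCoordRep_holds
    (k := ℂ) (σ := Literature.NumberTheory.DiophantineGeometry.MatIdx m)
    (Literature.NumberTheory.DiophantineGeometry.detFormLex ℂ m) (NeZero.ne m) (partitionWeightLex m lam)
  have hq : 0 < orbitMultiplicity ℂ (Literature.NumberTheory.DiophantineGeometry.detFormLex ℂ m) m
      (partitionWeightLex m lam) := by
    rw [Literature.NumberTheory.DiophantineGeometry.orbitMultiplicity,
      Literature.NumberTheory.DiophantineGeometry.hwMultiplicity, pos_iff_ne_zero, Ne,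
      Submodule.finrank_eq_zero]
    exact h
  exact hq.trans_le
    (Literature.NumberTheory.DiophantineGeometry.orbitMultiplicity_det_le_kroneckerCoeff_holds
      (k := ℂ) lam hlam)

/-- **IP Thm. 1.4 unconditionally at the threshold `n ^ 25 ≤ m` of Bürgisser–Ikenmeyer–Panova.**
For `0 < n`, `n ^ 25 ≤ m` and `λ ⊢ m·d` (at most `m²` parts) occurring in
`ℂ[\overline{GL_{m²} · X₀₀^{m-n} per_n}]` (IP's = BIP's padding, `bipPaddedPerOrbitRep`),
`g(λ, m × d, m × d) > 0`: by BIP's Thm. 1.4 ("if `λ` occurs in `ℂ[Z_{n,m}]`, then `λ` occurs in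
`ℂ[Ω_n]`", PROVED in the tree: `bip2019_no_occurrence_obstructions_holds`) the weight occurs in
`ℂ[Ω_m]`, and `kroneckerCoeff_pos_of_hasHighestWeight_detOrbitRep` applies. BIP state exactly this
consequence as their rendering of IP's theorem (BIP Thm. 1.5, with `k_n(λ) = g(λ, n × d, n × d)`),
at IP's better threshold `n > 3m⁴`; the present theorem is the part of it that BIP's own theorem
yields. [cite: BurgisserIkenmeyerPanovaJAMS2019, Thm. 1.4 and Thm. 1.5] -/
theorem ikenmeyerPanova2017_thm_1_4_of_pow_le {n m d : ℕ} [NeZero m] (hn : 0 < n)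
    (hnm : n ^ 25 ≤ m) (lam : Nat.Partition (m * d)) (hlam : lam.parts.card ≤ m * m)
    (h : HasHighestWeight (bipPaddedPerOrbitRep ℂ n m) (partitionWeightLex m lam)) :
    0 < kroneckerCoeff ℂ lam (Nat.Partition.rectangle m d) (Nat.Partition.rectangle m d) :=
  kroneckerCoeff_pos_of_hasHighestWeight_detOrbitRep lam hlam
    (bip2019_no_occurrence_obstructions_holds n m hn hnm _ h)

/-- **IP Thm. 1.4 (`ikenmeyerPanova2017_thm_1_4`, verbatim, all permanent sizes) from IP Thm. 4.6
alone.** The complete assembly `ikenmeyerPanova2017_thm_1_4_of_prop_2_8_of_thm_4_6_all` fed with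
the discharged Prop. 2.8 (`ikenmeyerPanova2017_prop_2_8_holds`, `OccurrenceObstructionsIPProofs.lean`).
Once the named fact `ikenmeyerPanova2017_thm_4_6` (IP's main Kronecker positivity theorem,
held: Thm. 23) is discharged, `ikenmeyerPanova2017_thm_1_4_holds` is this theorem applied to
`ikenmeyerPanova2017_thm_4_6_holds`.
[cite: IkenmeyerPanova2017, Thm. 1.4 (held: Thm. 4) and §1.1 (Proof of Thm. 1.4; held p. 5)] -/
theorem ikenmeyerPanova2017_thm_1_4_of_thm_4_6_all (h46 : ikenmeyerPanova2017_thm_4_6) :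
    ikenmeyerPanova2017_thm_1_4 :=
  ikenmeyerPanova2017_thm_1_4_of_prop_2_8_of_thm_4_6_all ikenmeyerPanova2017_prop_2_8_holds h46

end Addenda

/-! ### Unconditional pieces of the remaining range, from Bürgisser–Ikenmeyer–Panova's tools

Two consequences of BIP's proved propositions for the part of IP Thm. 1.4 that still rests on IP
Thm. 4.6 (`19 ≤ n`, `3n⁴ < m < n²⁵`), recorded for the discharge of Thm. 4.6 / Thm. 1.4; neither
is a printed statement of IP.

* `ikenmeyerPanova2017_lemma_4_2_even`: IP Lemma 4.2 (held: Lemma 19) — "`g(k × (ks) + (k(a-ks)),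
  a × k, a × k) > 0` for `a ≥ ks`", whose printed proof needs the square positivity
  `g(k × k, k × k, k × k) > 0` of Bessenrodt–Behns (the undischarged `ikenmeyerPanova2017_square_pos`)
  — holds UNCONDITIONALLY with the block width `ks` replaced by ANY EVEN `ℓ` with `kℓ ≤ a`: the
  shape `k × ℓ + (k(a-ℓ))` is BIP's row-extended even rectangle `(k × ℓ)♯(ka)`, which occurs in
  `ℂ[Ω_a]_k` by BIP Prop. 2.3 (`bip2019_prop_2_3_holds`: Cayley's hyperdeterminant at a padded power
  sum), so the Peter–Weyl bound gives `g((k × ℓ)♯(ka), a × k, a × k) ≥ 1`. (The frame constraint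
  `kℓ ≤ a` is `k` times stronger than the printed `ks ≤ a`; this costs nothing in IP's proof of
  Thm. 1.4, where Thm. 4.6 is applied with `|ν| ≤ a√ℓ ≪ ab/6`, but it does not give Thm. 4.6 with
  its printed constant `|ν| ≤ ab/6`.)
* `ikenmeyerPanova2017_thm_1_4_of_sq_mul_secondPart_sq_le`: IP Thm. 1.4 holds unconditionally for
  every `λ` with `n² λ₂² ≤ m` — bodies with at most `√m / n ≥ √3·n` columns, in particular all `λ`
  with `λ₂ ≤ n` (`ikenmeyerPanova2017_thm_1_4_of_secondPart_le`): in degrees `d ≤ m/n` by IP Cor. 1.6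
  (a theorem since Prop. 2.8 is), in degrees `d > m/n > 3n³` by BIP Prop. 6.1 ("extremely long first
  rows", `bip2019_prop_6_1_holds`, parameters `M = n`, `s = max(λ₂, 1)`: `n²s² ≤ m`, `n²s ≤ d`) and
  the Peter–Weyl bound. So Thm. 4.6 is needed only for bodies with more than `√m/n` columns. -/

section EvenBlocks

open Literature.NumberTheory.DiophantineGeometry (kroneckerCoeff HasHighestWeight)

/-- The rows of `k × ℓ + (k(a-ℓ))` (`ℓ ≤ a`, `0 < k`) are those of BIP's row-extended rectangle
`(k × ℓ)♯(ka)`: first row `ka - (k-1)ℓ = ℓ + k(a-ℓ)`, then `k - 1` rows of length `ℓ`.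
[cite: BurgisserIkenmeyerPanovaJAMS2019, §2(a) (`λ♯D`)] -/
theorem parts_rectangle_rowAdd_indiscrete_eq_rowExtendedRectangle {k ℓ a : ℕ} (hk : 0 < k)
    (hℓa : ℓ ≤ a) :
    ((Nat.Partition.rectangle k ℓ).rowAdd (Nat.Partition.indiscrete (k * (a - ℓ)))).parts =
      (rowExtendedRectangle k ℓ (k * a)).parts := by
  have hkℓ : k * ℓ ≤ k * a := Nat.mul_le_mul_left k hℓa
  refine parts_eq_of_getD_sortedParts_eq fun r => ?_
  rw [getD_sortedParts_rowAdd, getD_sortedParts_rectangle, getD_sortedParts_indiscrete,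
    rowExtendedRectangle, getD_sortedParts_partitionOfRows (antitone_rowExtRectRows hkℓ)
      (sum_range_rowExtRectRows hk hkℓ)]
  obtain ⟨c, rfl⟩ : ∃ c, a = ℓ + c := ⟨a - ℓ, by omega⟩
  obtain ⟨k', rfl⟩ : ∃ k', k = k' + 1 := ⟨k - 1, by omega⟩
  have hsub : ℓ + c - ℓ = c := by omega
  simp only [rowExtRectRows, hsub]
  have hmul : (k' + 1) * (ℓ + c) - k' * ℓ = ℓ + (k' + 1) * c := by
    have h1 : (k' + 1) * (ℓ + c) = k' * ℓ + (ℓ + (k' + 1) * c) := by ring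
    omega
  by_cases hr0 : r = 0
  · subst hr0
    simp
    exact hmul.symm
  · by_cases hrk : r < k' + 1
    · simp [hr0, hrk]
    · simp [hr0, hrk]

/-- **IP Lemma 4.2 (held: Lemma 19) for even block widths, unconditionally.** "Let
`μ = (k × (ks))` and `a ≥ ks`, then `g(k × (ks) + (k(a-ks)), a × k, a × k) > 0`": here with the
width `ks` replaced by any even `ℓ ≥ 2` such that `kℓ ≤ a` (so for `ks` itself whenever `ks` is even
and `k²s ≤ a`), and WITHOUT the square positivity of Bessenrodt–Behns used in print. Proof: the
shape `k × ℓ + (k(a-ℓ)) ⊢ ak` has the rows of BIP's `(k × ℓ)♯(ka)`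
(`parts_rectangle_rowAdd_indiscrete_eq_rowExtendedRectangle`), which occurs in `ℂ[Ω_a]_k` for even
`ℓ` with `kℓ ≤ a` by BIP Prop. 2.3 (`bip2019_prop_2_3_holds`); occurrence in `ℂ[Ω_a]_k` gives
`g(·, a × k, a × k) ≥ 1` (`kroneckerCoeff_pos_of_hasHighestWeight_detOrbitRep`). The shape is
described by its parts (`hmu`), as in `ikenmeyerPanova2017_lemma_4_2_of_props`.
[cite: IkenmeyerPanova2017, Lemma 4.2 (held: Lemma 19, p. 9); BurgisserIkenmeyerPanovaJAMS2019, Prop. 2.3] -/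
theorem ikenmeyerPanova2017_lemma_4_2_even {k ℓ a : ℕ} (hk : 0 < k) (hℓ0 : 0 < ℓ) (hℓ : Even ℓ)
    (hkℓ : k * ℓ ≤ a) (mu : Nat.Partition (a * k))
    (hmu : mu.parts = ((Nat.Partition.rectangle k ℓ).rowAdd
      (Nat.Partition.indiscrete (k * (a - ℓ)))).parts) :
    0 < kroneckerCoeff ℂ mu (Nat.Partition.rectangle a k) (Nat.Partition.rectangle a k) := by
  have ha : 0 < a := lt_of_lt_of_le (Nat.mul_pos hk hℓ0) hkℓ
  haveI : NeZero a := ⟨ha.ne'⟩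
  have hℓa : ℓ ≤ a := le_trans (Nat.le_mul_of_pos_left ℓ hk) hkℓ
  have hka : k ≤ a := le_trans (Nat.le_mul_of_pos_right k hℓ0) hkℓ
  -- BIP Prop. 2.3: `(k × ℓ)♯(ka)` occurs in `ℂ[Ω_a]_k`
  have hocc := bip2019_prop_2_3_holds a k ℓ hk hℓ0 hℓ hkℓ
  set R := rowExtendedRectangle k ℓ (k * a) with hR
  let R' : Nat.Partition (a * k) := ⟨R.parts, R.parts_pos, by rw [R.parts_sum, mul_comm]⟩
  have hw : partitionWeightLex a R' = partitionWeightLex a R := rfl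
  have hkℓ' : k * ℓ ≤ k * a := Nat.mul_le_mul_left k hℓa
  have hR'card : R'.parts.card ≤ a * a :=
    (card_parts_partitionOfRows_le (antitone_rowExtRectRows hkℓ') (sum_range_rowExtRectRows hk hkℓ')).trans
      (hka.trans (Nat.le_mul_self a))
  rw [← hw] at hocc
  have hpos : 0 < kroneckerCoeff ℂ R' (Nat.Partition.rectangle a k) (Nat.Partition.rectangle a k) :=
    kroneckerCoeff_pos_of_hasHighestWeight_detOrbitRep R' hR'card hocc
  have hparts : mu.parts = R'.parts :=
    hmu.trans (parts_rectangle_rowAdd_indiscrete_eq_rowExtendedRectangle hk hℓa)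
  rwa [← kroneckerCoeff_congr_parts rfl (lam := mu) (lam' := R') (mu := Nat.Partition.rectangle a k)
    (nu := Nat.Partition.rectangle a k) hparts rfl rfl] at hpos

/-- The same blocks in the transposed frame `k × a` (`k` rows of length `a`), the orientation in
which they are stacked in IP's proof of Thm. 4.6 (summands (I), (II): bodies `(k-1) × ℓ`, i.e.
`ℓ` columns of length `k - 1`, at the cost of `k` rows): for even `ℓ ≥ 2` with `kℓ ≤ a`,
`g(k × ℓ + (k(a-ℓ)), k × a, k × a) > 0`, by the transposition property
(`kroneckerCoeff_rectangle_swap`, `ikenmeyerPanova2017_transposition_holds`).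
[cite: IkenmeyerPanova2017, Lemma 4.2 (proof; held: Lemma 19, p. 9); BurgisserIkenmeyerPanovaJAMS2019, Prop. 2.3] -/
theorem ikenmeyerPanova2017_lemma_4_2_even' {k ℓ a : ℕ} (hk : 0 < k) (hℓ0 : 0 < ℓ) (hℓ : Even ℓ)
    (hkℓ : k * ℓ ≤ a) (mu : Nat.Partition (k * a))
    (hmu : mu.parts = ((Nat.Partition.rectangle k ℓ).rowAdd
      (Nat.Partition.indiscrete (k * (a - ℓ)))).parts) :
    0 < kroneckerCoeff ℂ mu (Nat.Partition.rectangle k a) (Nat.Partition.rectangle k a) := by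
  let mu' : Nat.Partition (a * k) := ⟨mu.parts, mu.parts_pos, by rw [mu.parts_sum, mul_comm]⟩
  rw [← kroneckerCoeff_rectangle_swap ikenmeyerPanova2017_transposition_holds mu' mu rfl]
  exact ikenmeyerPanova2017_lemma_4_2_even hk hℓ0 hℓ hkℓ mu' hmu

end EvenBlocks

section FewColumns

open Literature.NumberTheory.DiophantineGeometry (kroneckerCoeff HasHighestWeight MatIdx)

/-- **Padding-free core: few columns.** Let `0 < M`, `3M⁴ < m`, and let `λ ⊢ m·d` (at most `m²`
parts) satisfy `ℓ(λ) ≤ M²`, `|λ̄| ≤ M d`, `M² λ₂² ≤ m`, and occur in `ℂ[Sym^m V^*]` (`a_λ > 0`). Then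
`g(λ, m × d, m × d) > 0`. If `M d ≤ m`, IP Cor. 1.6 (the theorem
`ikenmeyerPanova2017_cor_1_6_of_prop_2_8 ikenmeyerPanova2017_prop_2_8_holds`) gives `0 < a_λ ≤ g`.
Else `m < M d`; with `s := max(λ₂, 1)` one has `M² s² ≤ m` (for `s = 1` because `M² ≤ 3M⁴ < m`)
and `M² s ≤ d` (if `s ≤ M`: `M·M³ ≤ 3M⁴ < m < M d`; if `s > M`: `M·(M s²) ≤ m < M d` and
`M² s ≤ M s²`), so BIP Prop. 6.1 (`bip2019_prop_6_1_holds`) puts `λ` into `ℂ[Ω_m]_d` and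
`kroneckerCoeff_pos_of_hasHighestWeight_detOrbitRep` concludes. Not a printed statement.
[cite: BurgisserIkenmeyerPanovaJAMS2019, Prop. 6.1; IkenmeyerPanova2017, Cor. 1.6 and §1.1 (Proof of Thm. 1.4)] -/
theorem kroneckerCoeff_pos_of_sq_mul_secondPart_sq_le {m d M : ℕ} [NeZero m] (hM : 0 < M)
    (hMm : 3 * M ^ 4 < m) (lam : Nat.Partition (m * d)) (hlam : lam.parts.card ≤ m * m)
    (hℓ : lam.parts.card ≤ M ^ 2) (hbody : bodySize lam ≤ M * d)
    (hcols : M ^ 2 * secondPart lam ^ 2 ≤ m)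
    (hocc : HasHighestWeight (AlgebraicComplexity.coordRep (MatIdx m) ℂ m) (partitionWeightLex m lam)) :
    0 < kroneckerCoeff ℂ lam (Nat.Partition.rectangle m d) (Nat.Partition.rectangle m d) := by
  have hM4 : M ^ 4 < m := lt_of_le_of_lt (Nat.le_mul_of_pos_left _ (by norm_num)) hMm
  have hMm' : M < m := lt_of_le_of_lt (Nat.le_self_pow (by norm_num) M) hM4
  have hM2m : M ^ 2 ≤ m := (Nat.pow_le_pow_right hM (by norm_num : 2 ≤ 4)).trans hM4.le
  by_cases hdeg : m < M * d
  · -- large degree: BIP Prop. 6.1 with `s = max(λ₂, 1)`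
    set s := max (secondPart lam) 1 with hs
    have hs0 : 0 < s := lt_of_lt_of_le Nat.one_pos (le_max_right _ _)
    have h2 : secondPart lam ≤ s := le_max_left _ _
    have hsm : M ^ 2 * s ^ 2 ≤ m := by
      rcases le_or_gt (secondPart lam) 1 with h1 | h1
      · have hs1 : s = 1 := by rw [hs]; exact max_eq_right h1
        rw [hs1]; simpa using hM2m
      · have hs1 : s = secondPart lam := by rw [hs]; exact max_eq_left h1.le
        rw [hs1]; exact hcols
    have hsd : M ^ 2 * s ≤ d := by
      rcases le_or_gt s M with hsM | hsM
      · -- `M² s ≤ M³ < d`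
        have h3 : M ^ 3 < d := by
          have h' : M * M ^ 3 < M * d := by
            calc M * M ^ 3 = M ^ 4 := by ring
              _ < m := hM4
              _ < M * d := hdeg
          exact Nat.lt_of_mul_lt_mul_left h'
        calc M ^ 2 * s ≤ M ^ 2 * M := Nat.mul_le_mul_left _ hsM
          _ = M ^ 3 := by ring
          _ ≤ d := h3.le
      · -- `M² s ≤ M s² < d`
        have h3 : M * s ^ 2 < d := by
          have h' : M * (M * s ^ 2) < M * d := by
            calc M * (M * s ^ 2) = M ^ 2 * s ^ 2 := by ring
              _ ≤ m := hsm
              _ < M * d := hdeg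
          exact Nat.lt_of_mul_lt_mul_left h'
        calc M ^ 2 * s = M * (M * s) := by ring
          _ ≤ M * (s * s) := Nat.mul_le_mul_left _ (Nat.mul_le_mul_right _ hsM.le)
          _ = M * s ^ 2 := by ring
          _ ≤ d := h3.le
    let lam' : Nat.Partition (d * m) := ⟨lam.parts, lam.parts_pos, by rw [lam.parts_sum, mul_comm]⟩
    have hw : partitionWeightLex m lam' = partitionWeightLex m lam := rfl
    have h2' : secondPart lam' ≤ s := h2
    rw [← hw] at hocc
    have hdet := hasHighestWeight_detOrbitRep_of_prop_6_1 bip2019_prop_6_1_holds hs0 hM lam' hℓ h2'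
      hsm hsd hocc
    exact kroneckerCoeff_pos_of_hasHighestWeight_detOrbitRep lam hlam hdet
  · -- small degree: IP Cor. 1.6 (a theorem, Prop. 2.8 being discharged)
    have ha := plethysmCoeff_pos_of_hasHighestWeight hocc
    by_contra hg
    have hg0 : kroneckerCoeff ℂ lam (Nat.Partition.rectangle m d) (Nat.Partition.rectangle m d) = 0 :=
      Nat.eq_zero_of_not_pos hg
    refine hdeg (ikenmeyerPanova2017_cor_1_6_of_prop_2_8 ikenmeyerPanova2017_prop_2_8_holds m d M hM
      hMm' lam hlam hbody ?_)
    rw [hg0]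
    exact ha

/-- **IP Thm. 1.4 unconditionally for bodies with at most `√m / n` columns.** For `0 < n`,
`3n⁴ < m`, and `λ ⊢ m·d` (at most `m²` parts) occurring in `ℂ[\overline{GL_{m²} · X₀₀^{m-n} per_n}]`
(IP's padding) with `n² λ₂² ≤ m`, one has `g(λ, m × d, m × d) > 0` — with no appeal to IP Thm. 4.6:
Kadish–Landsberg (`bip2019_thm_2_1_holds`) gives `ℓ(λ) ≤ n²`, `|λ̄| ≤ n d`, the BLMW lift
(`hlift_matIdx`) gives `a_λ > 0`, and `kroneckerCoeff_pos_of_sq_mul_secondPart_sq_le` (IP Cor. 1.6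
for `d ≤ m/n`, BIP Prop. 6.1 for `d > m/n`) concludes. Not a printed statement: it isolates what of
`ikenmeyerPanova2017_thm_1_4` remains conditional on Thm. 4.6 — the bodies with more than
`√m/n ≥ √3·n` columns (in degrees `d > m/n`, for `19 ≤ n`, `m < n²⁵`).
[cite: IkenmeyerPanova2017, Thm. 1.4 (held: Thm. 4) and §1.1; BurgisserIkenmeyerPanovaJAMS2019, Prop. 6.1] -/
theorem ikenmeyerPanova2017_thm_1_4_of_sq_mul_secondPart_sq_le {n m d : ℕ} [NeZero m] (hn : 0 < n)
    (hnm : 3 * n ^ 4 < m) (lam : Nat.Partition (m * d)) (hlam : lam.parts.card ≤ m * m)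
    (hcols : n ^ 2 * secondPart lam ^ 2 ≤ m)
    (h : HasHighestWeight (bipPaddedPerOrbitRep ℂ n m) (partitionWeightLex m lam)) :
    0 < kroneckerCoeff ℂ lam (Nat.Partition.rectangle m d) (Nat.Partition.rectangle m d) := by
  have hnm' : n ≤ m := by
    calc n ≤ n ^ 4 := Nat.le_self_pow (by norm_num) n
      _ ≤ 3 * n ^ 4 := Nat.le_mul_of_pos_left _ (by norm_num)
      _ ≤ m := hnm.le
  -- Kadish–Landsberg: the partition form of the weight, `ℓ(λ) ≤ n²`, `|λ̄| ≤ n d`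
  obtain ⟨D, lam', hℓ', hbody', hw⟩ := bip2019_thm_2_1_holds n m hn hnm' _ h
  have hl' : lam'.parts.card ≤ m * m :=
    hℓ'.trans ((Nat.pow_le_pow_left hnm' 2).trans_eq (sq m))
  have hparts : lam.parts = lam'.parts := parts_eq_of_partitionWeightLex_eq hw hlam hl'
  have hℓ : lam.parts.card ≤ n ^ 2 := by rw [hparts]; exact hℓ'
  have hsize : m * d = D * m := by rw [← lam.parts_sum, hparts, lam'.parts_sum]
  have hD : D = d := by
    rw [mul_comm D m] at hsize
    exact (Nat.eq_of_mul_eq_mul_left (NeZero.pos m) hsize).symm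
  subst hD
  have hbody : bodySize lam ≤ n * D := by
    unfold bodySize at hbody' ⊢
    rw [hparts, hsize]
    exact hbody'
  -- the BLMW lift: `a_λ > 0`
  have hocc : HasHighestWeight (AlgebraicComplexity.coordRep (MatIdx m) ℂ m) (partitionWeightLex m lam) :=
    hlift_matIdx m (Complexity.bipPaddedPerFormLex ℂ n m) (NeZero.ne m)
      (Complexity.bipPaddedPerFormLex_isHomogeneous (k := ℂ) hnm') h
  exact kroneckerCoeff_pos_of_sq_mul_secondPart_sq_le hn hnm lam hlam hℓ hbody hcols hocc

/-- **IP Thm. 1.4 unconditionally for `λ₂ ≤ n`** (bodies with at most `n` columns): the case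
`n² λ₂² ≤ n⁴ ≤ 3n⁴ < m` of `ikenmeyerPanova2017_thm_1_4_of_sq_mul_secondPart_sq_le`.
[cite: IkenmeyerPanova2017, Thm. 1.4 (held: Thm. 4); BurgisserIkenmeyerPanovaJAMS2019, Prop. 6.1] -/
theorem ikenmeyerPanova2017_thm_1_4_of_secondPart_le {n m d : ℕ} [NeZero m] (hn : 0 < n)
    (hnm : 3 * n ^ 4 < m) (lam : Nat.Partition (m * d)) (hlam : lam.parts.card ≤ m * m)
    (hcols : secondPart lam ≤ n)
    (h : HasHighestWeight (bipPaddedPerOrbitRep ℂ n m) (partitionWeightLex m lam)) :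
    0 < kroneckerCoeff ℂ lam (Nat.Partition.rectangle m d) (Nat.Partition.rectangle m d) := by
  refine ikenmeyerPanova2017_thm_1_4_of_sq_mul_secondPart_sq_le hn hnm lam hlam ?_ h
  calc n ^ 2 * secondPart lam ^ 2 ≤ n ^ 2 * n ^ 2 :=
        Nat.mul_le_mul_left _ (Nat.pow_le_pow_left hcols 2)
    _ = n ^ 4 := by ring
    _ ≤ 3 * n ^ 4 := Nat.le_mul_of_pos_left _ (by norm_num)
    _ ≤ m := hnm.le

end FewColumns

end Literature.Computability.Complexity
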